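import Summits.HodgeConjecture.CorCM.HypDel.M1primeOfFUPart7
import Literature.AlgebraicGeometry.HodgeTheory.AbelianVarietyBettiFormsComparisonDeRham
import Literature.AlgebraicGeometry.HodgeTheory.HodgeStructureOfHodgeModel
import HarnessLib

/-!
# The ordered cup frame of a lattice frame is linearly independent (Siegel universal family, assembler socket (I))

Sub-problem `HodgeConjecture` (cell HC_CM, (U)-lane node P4, engine (N3-core) «the polarisation Gram is flat in a flat
integral frame», ASSEMBLER SOCKET (I) `UHead.Ue_N3asm_cupFrameIndependent` of the P4 lead's sockets file v0.10).

For a complex torus `X = E/Φ(ℤ^ι)` on a finite index type `ι` ordered through `e : ι ≃ Fin n`, a space `Y` under `X`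
(`ψ : X → Y`, e.g. a homeomorphism onto a fibre of the universal family) and classes `γ_a ∈ H¹(Y; ℚ)` pulling back to the
canonical lattice classes `ξ_a = latticeClass Φ a` ([Lange2023AbelianVarietiesComplex] §1.1.3 Lemma 1.1.17 (a)), the complexified products
`(γ_a ⊗ 1) ⌣ (γ_b ⊗ 1)`, `e a < e b`, are `ℂ`-linearly independent in `H²(Y; ℂ)`
(`linearIndependent_cupProduct_ofRatClass_of_map_eq_latticeClass`): pulled back to `X` they are `(ξ_a ⌣ ξ_b) ⊗ 1 =
e₀,X[dx_a ∧ dx_b]` (the de Rham isomorphism of record, ★ `complexify_cconstClass_latMonomial_eq_ringChange_cupPowOne`,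
[Lange2023] Prop. 1.1.20 «the cup product corresponds to the exterior product»), and the lattice monomials `dx_w`, `w`
increasing, are a basis of the invariant forms (★ `latMonomialBasis`).  §2 discharges the socket text BINDER FOR BINDER
(`ue_N3asm_cupFrameIndependent_holds`) for the fibres of `W1.univFamilyℂ 𝓜` identified with `A_y(ℂ)` through the pinned
isomorphism and uniformised by `φ y`, order `finSumFinEquiv` on `Fin g ⊕ Fin g`.

HC_CM is proved only modulo the 7 printed citations until rung 0 closes; this file is unconditional.
-/

set_option autoImplicit false
set_option linter.dupNamespace false

noncomputable section

-- `ComplexTorus Φ'` (for `Φ' : ℝⁿ ≃ E`) is the type `Torus n = (ℝ/ℤ)ⁿ`; instance paths up to unfolding (as in row A1-30⁺⁺)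
set_option backward.isDefEq.respectTransparency false

open CategoryTheory CategoryTheory.Limits AlgebraicGeometry Matrix Topology
open Literature.AlgebraicGeometry
open Literature.AlgebraicGeometry.Motives (SchemeOver ComplexPoints AlgPoints specOver AbelianVariety CartierDivisor fiberOver)
open Literature.AlgebraicGeometry.HodgeTheory (ofRatClass ofRatClass_eq_ringChange latticeClass
  complexify_cconstClass_latMonomial_eq_ringChange_cupPowOne)
open Literature.AlgebraicGeometry.AbelianSchemes (PolarizedAbelianSchemeWithLevel AbelianSchemeOver)
open Literature.AlgebraicGeometry.ModuliOfAbelianVarieties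
open Literature.AlgebraicGeometry.ModuliOfAbelianVarieties.SiegelModuli
open Literature.Geometry.Kaehler (ComplexTorus)
open Literature.NumberTheory.Transcendental (IsAnalytification integrationDeRhamIsoFamily)
open Literature.AlgebraicTopology.SingularHomology

namespace Summit.HodgeConjecture.HodgeConjecture.Theorems

namespace UnivFamilyCupFrame

/-! ### §1 Generic torus bookkeeping: the ordered cup frame of a lattice frame is independent -/

section Generic

variable {R : Type} [CommRing R]

/-- `m₂(v) = v 0 ⌣ v 1` for the iterated cup product of degree-one classes. [cite: HatcherAT2002, §3.2 Prop. 3.10] -/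
theorem cupPowOne_two_eq_cupProduct {Y : Type} [TopologicalSpace Y] (v : Fin 2 → singularCohomology R R Y 1) :
    cupPowOne R Y 2 v = cupProduct (Nat.add_comm 1 1) (v 0) (v 1) := by
  rw [cupPowOne_succ, cupPowOne_one]
  rfl

variable {ι : Type} [Fintype ι] {E : Type} [NormedAddCommGroup E] [NormedSpace ℂ E] [FiniteDimensional ℂ E]
  (Φ : (ι → ℝ) ≃L[ℝ] E) {n : ℕ} (e : ι ≃ Fin n) {Y : Type} [TopologicalSpace Y]

/-- **The pulled-back cup frame is the de Rham frame of record**: for `ψ : X → Y` and `γ_a ∈ H¹(Y; ℚ)` with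
`ψ^* γ_a = ξ_a`, `ψ^*((γ_a ⊗ 1) ⌣ (γ_b ⊗ 1)) = e₀,X[dx_a ∧ dx_b]` in `H²(X; ℂ)` (naturality of `⌣` and of `⊗ 1`;
[Lange2023] Prop. 1.1.20 through ★ `complexify_cconstClass_latMonomial_eq_ringChange_cupPowOne`).
[cite: Lange2023AbelianVarietiesComplex, §1.1.4 Prop. 1.1.20] [cite: HatcherAT2002, §3.2 Prop. 3.10] -/
theorem map_cupProduct_ofRatClass_eq_complexify_latMonomial (ψ : C(ComplexTorus Φ, Y))
    (γ : ι → singularCohomology ℚ ℚ Y 1)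
    (hγ : ∀ a, singularCohomology.map ℚ ℚ ψ 1 (γ a) = latticeClass Φ a) (a b : ι) :
    singularCohomology.map ℂ ℂ ψ 2
        (cupProduct (show 1 + 1 = 2 from rfl) (ofRatClass Y 1 (γ a)) (ofRatClass Y 1 (γ b))) =
      (integrationDeRhamIsoFamily E).complexify (ComplexTorus Φ) 2
        (ComplexTorus.cconstClass Φ (ComplexTorus.latMonomial Φ 2 ![a, b])) := by
  rw [complexify_cconstClass_latMonomial_eq_ringChange_cupPowOne, cupPowOne_two_eq_cupProduct,
    singularCohomology.ringChange_cupProduct, cupProduct_map, ofRatClass_eq_ringChange, ofRatClass_eq_ringChange,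
    ← singularCohomology.ringChange_map, ← singularCohomology.ringChange_map, hγ, hγ]
  rfl

/-- **The ordered cup frame of a lattice frame is `ℂ`-linearly independent**: for `ψ : X = E/Φ(ℤ^ι) → Y`, classes
`γ_a ∈ H¹(Y; ℚ)` with `ψ^* γ_a = ξ_a` and an enumeration `e : ι ≃ Fin n`, the family `(γ_a ⊗ 1) ⌣ (γ_b ⊗ 1)`, `e a < e b`,
is linearly independent in `H²(Y; ℂ)` — its pull-back to `X` is `e₀,X[dx_a ∧ dx_b]`, and the increasing lattice monomials
are a basis of the invariant `2`-forms (`H²(X) = ⋀² H¹(X)`). [cite: Lange2023AbelianVarietiesComplex, §1.1.4 Prop. 1.1.20]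
[cite: Lange2023AbelianVarietiesComplex, §1.1.3 Lemma 1.1.17 (a) (p. 14)] -/
theorem linearIndependent_cupProduct_ofRatClass_of_map_eq_latticeClass (ψ : C(ComplexTorus Φ, Y))
    (γ : ι → singularCohomology ℚ ℚ Y 1)
    (hγ : ∀ a, singularCohomology.map ℚ ℚ ψ 1 (γ a) = latticeClass Φ a) :
    LinearIndependent ℂ fun j : {ab : ι × ι // e ab.1 < e ab.2} ↦
      cupProduct (show 1 + 1 = 2 from rfl) (ofRatClass Y 1 (γ j.1.1)) (ofRatClass Y 1 (γ j.1.2)) := by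
  classical
  refine LinearIndependent.of_comp (singularCohomology.map ℂ ℂ ψ 2).hom ?_
  have hfam : ((singularCohomology.map ℂ ℂ ψ 2).hom : _ → _) ∘
      (fun j : {ab : ι × ι // e ab.1 < e ab.2} ↦
        cupProduct (show 1 + 1 = 2 from rfl) (ofRatClass Y 1 (γ j.1.1)) (ofRatClass Y 1 (γ j.1.2))) =
      (⇑(((integrationDeRhamIsoFamily E).complexify (ComplexTorus Φ) 2).toLinearMap ∘ₗ ComplexTorus.cconstClass Φ)) ∘
        fun j : {ab : ι × ι // e ab.1 < e ab.2} ↦ ComplexTorus.latMonomial Φ 2 ![j.1.1, j.1.2] := by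
    funext j
    exact map_cupProduct_ofRatClass_eq_complexify_latMonomial Φ ψ γ hγ j.1.1 j.1.2
  rw [hfam]
  -- the increasing lattice monomials are part of a basis of the invariant `2`-forms
  letI : LinearOrder ι := LinearOrder.lift' e e.injective
  let w : {ab : ι × ι // e ab.1 < e ab.2} → {w : Fin 2 → ι // StrictMono w} := fun j ↦
    ⟨![j.1.1, j.1.2], Fin.strictMono_iff_lt_succ.mpr fun i ↦ by
      fin_cases i
      exact j.2⟩
  have hw : Function.Injective w := fun j₁ j₂ h ↦ by
    have h0 := congrArg (fun u : {w : Fin 2 → ι // StrictMono w} ↦ u.1 0) h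
    have h1 := congrArg (fun u : {w : Fin 2 → ι // StrictMono w} ↦ u.1 1) h
    exact Subtype.ext (Prod.ext h0 h1)
  have hli : LinearIndependent ℂ fun j : {ab : ι × ι // e ab.1 < e ab.2} ↦ ComplexTorus.latMonomial Φ 2 ![j.1.1, j.1.2] := by
    have h := (ComplexTorus.latMonomialBasis Φ 2).linearIndependent.comp w hw
    convert h using 1
    funext j
    simp only [Function.comp_apply, ComplexTorus.latMonomialBasis_apply, w]
  refine hli.map' _ (LinearMap.ker_eq_bot.mpr ?_)
  exact ((integrationDeRhamIsoFamily E).complexify (ComplexTorus Φ) 2).injective.comp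
    (ComplexTorus.cconstClassEquiv Φ (k := 2)).injective

end Generic

/-! ### §2 The assembler socket (I), binder for binder -/

/-- **ASSEMBLER SOCKET (I) «THE ORDERED CUP FRAME OF A LATTICE FRAME IS INDEPENDENT» — discharged.**  For a fibre `X_y`
of `W1.univFamilyℂ 𝓜` identified with `A_y(ℂ)` through the pinned isomorphism and uniformised by
`φ : ℂ^g/Φ(ℤ^{2g}) → A_y(ℂ)` with `(e_y ∘ φ)^* (γ a) = ξ_a`, the classes `(γ a ⊗ 1) ⌣ (γ b ⊗ 1)`, `a < b` in the order of
`Fin (g+g)` through `finSumFinEquiv`, are `ℂ`-linearly independent in `H²(X_y(ℂ); ℂ)` (§1 with `ψ = e_y ∘ φ`,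
`e = finSumFinEquiv`).  Statement = the socket text of v0.10 verbatim. [cite: Lange2023AbelianVarietiesComplex, §1.1.3 Lemma 1.1.17 (a) (p. 14)]
[cite: Lange2023AbelianVarietiesComplex, §1.1.4 Prop. 1.1.20] -/
theorem ue_N3asm_cupFrameIndependent_holds :
  ∀ (g N : ℕ) (δ : Fin g → ℕ) (_hg : 0 < g) (_hδ : IsPolarizationType δ) (_hN : 3 ≤ N)
    (𝓜 : SiegelFineModuliScheme g N δ),
    haveI : IsLocallyNoetherian (specOver ℚ ℂ).left :=
      inferInstanceAs (IsLocallyNoetherian (Spec (CommRingCat.of ℂ)))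
    ∀ (y : ComplexPoints ((Motives.baseChange ℚ ℂ).obj 𝓜.M))
      (P' : PolarizedAbelianSchemeWithLevel g N δ (specOver ℚ ℂ).left)
      (G : P'.A.X.left ⟶ 𝓜.univ.A.X.left) (Ĝ : P'.D.hat.X.left ⟶ 𝓜.univ.D.hat.X.left)
      (hbc : P'.IsBaseChangeVia 𝓜.univ ((AlgPoints.baseChangeEquiv (algebraMap ℚ ℂ) 𝓜.M).symm y).left G Ĝ)
      (γ : Fin g ⊕ Fin g → singularCohomology ℚ ℚ (ComplexPoints (fiberOver (W1.univFamilyℂ 𝓜) y)) 1)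
      (Φ : (Fin g ⊕ Fin g → ℝ) ≃L[ℝ] (Fin g → ℂ))
      (φ : C(ComplexTorus Φ, (P'.A.fibre (𝟙 (Spec (CommRingCat.of ℂ)))).toAbelianVariety.Points ℂ)),
      IsAnalytification (Fin g → ℂ) (P'.A.fibre (𝟙 (Spec (CommRingCat.of ℂ)))).toAbelianVariety.X
        (P'.A.fibre (𝟙 (Spec (CommRingCat.of ℂ)))).toAbelianVariety.dim φ →
      (∀ a : Fin g ⊕ Fin g,
        singularCohomology.map ℚ ℚ
            (((Motives.AlgPoints.homeomorphOfIso (L := ℂ)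
                (W1.fibreAVIso P' ≪≫ (W1.fiberUnivIsoOfIsBaseChangeVia 𝓜 y P' G Ĝ hbc).symm) :
                (P'.A.fibre (𝟙 (Spec (CommRingCat.of ℂ)))).toAbelianVariety.Points ℂ ≃ₜ
                  ComplexPoints (fiberOver (W1.univFamilyℂ 𝓜) y)) :
              C((P'.A.fibre (𝟙 (Spec (CommRingCat.of ℂ)))).toAbelianVariety.Points ℂ,
                ComplexPoints (fiberOver (W1.univFamilyℂ 𝓜) y))).comp φ) 1 (γ a) =
          HodgeTheory.latticeClass Φ a) →
      LinearIndependent ℂ fun j : {ab : (Fin g ⊕ Fin g) × (Fin g ⊕ Fin g) //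
          (finSumFinEquiv ab.1 : Fin (g + g)) < finSumFinEquiv ab.2} ↦
        cupProduct (show 1 + 1 = 2 from rfl) (ofRatClass _ 1 (γ j.1.1)) (ofRatClass _ 1 (γ j.1.2)) := by
  intro g N δ _hg _hδ _hN 𝓜 y P' G Ĝ hbc γ Φ φ _hφ hframe
  exact linearIndependent_cupProduct_ofRatClass_of_map_eq_latticeClass Φ finSumFinEquiv _ γ hframe

end UnivFamilyCupFrame

end Summit.HodgeConjecture.HodgeConjecture.Theorems

end
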